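import Summits.AtomisticToContinuum.HydrodynamicLimit.Theses.OneFlightGossipEngine
import Summits.AtomisticToContinuum.HydrodynamicLimit.Theorems.OneFlightGossipEngineClampedCurrentsDockClampRemainder
import Literature.Analysis.FluidPDE.HardSphereCollisionRecord
import Literature.Analysis.FluidPDE.HardSphereFlowJointMeasurable
import Literature.Analysis.FluidPDE.CollisionalTransfer
import Literature.Analysis.FunctionSpaces.TorusCalculusProofs
import Literature.MathematicalPhysics.KineticTheory.HardSphereEulerProofs
import Summits.AtomisticToContinuum.HydrodynamicLimit.Theorems.ImplosionDichotomyPolynomialCompressionUniquenessPrimitive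
import Summits.AtomisticToContinuum.HydrodynamicLimit.Theorems.CollisionIsometryCLTCollisionalTransferLocalityBalanceIdentity
import HarnessLib

/-!
# Collisional identification for Yau's entropy ledger — preliminaries (crux `ClampedCurrentsDock`, stmt-14680, line `IdeatorTwoSketch`)

Helper file (`--supports stmt-AtomisticToContinuum-14680`) for the registered stub CC1 `stub_collisionalIdentification`
(proved in the companion file `…CollisionalId.lean`, which imports this one): torus quotient/inverse rules for partial
derivatives, additivity of collision sums over finitely many collision times, interval-integrability of continuous one-body
functionals along a good hard-sphere orbit, the contact-scale bound of the frozen pair kernel, and continuity of the EOS-projection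
integrands. Split off the stub file for the 400-line limit. prover-line-stmt-AtomisticToContinuum-14680-c2-0 (stub worker CC1).
-/

noncomputable section

namespace Summit.AtomisticToContinuum.HydrodynamicLimit.Theorems.ClampedCurrentsDockCollisionalIdPrelim


open scoped BigOperators ENNReal Classical Interval
open MeasureTheory Filter Set Topology InformationTheory
open Literature.MathematicalPhysics.KineticTheory Literature.Analysis.FluidPDE Literature.Analysis.FunctionSpaces
open Summit.AtomisticToContinuum.HydrodynamicLimit.Theses.OneFlightGossipEngine
open Summit.AtomisticToContinuum.HydrodynamicLimit.Theorems

/-! ## §1 Torus calculus: quotient and inverse rules for partial derivatives -/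

/-- **Quotient rule** for torus partial derivatives: `∂ᵢ(a/b) = (∂ᵢa · b − a · ∂ᵢb)/b²` for `C¹` scalar fields
with `b ≠ 0`. [folklore] -/
theorem partialDeriv_div {a b : T3 → ℝ} (ha : Torus.IsContDiff 1 a) (hb : Torus.IsContDiff 1 b)
    (hb0 : ∀ x, b x ≠ 0) (i : Fin 3) (x : T3) :
    Torus.partialDeriv i (fun y => a y / b y) x =
      (Torus.partialDeriv i a x * b x - a x * Torus.partialDeriv i b x) / b x ^ 2 := by
  have h := ((hasDerivAt_coordLine ha x i).div (hasDerivAt_coordLine hb x i) (hb0 _)).deriv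
  simp only [zero_smul, Torus.proj_zero, add_zero] at h
  exact h

/-- **Inverse rule** for torus partial derivatives: `∂ᵢ(−b⁻¹) = ∂ᵢb/b²` for a `C¹` scalar field `b ≠ 0`
(the gradient of the energy-row test function `φ_e = −θ⁻¹`). [folklore] -/
theorem partialDeriv_neg_inv {b : T3 → ℝ} (hb : Torus.IsContDiff 1 b) (hb0 : ∀ x, b x ≠ 0)
    (i : Fin 3) (x : T3) :
    Torus.partialDeriv i (fun y => -(b y)⁻¹) x = Torus.partialDeriv i b x / b x ^ 2 := by
  have h := (((hasDerivAt_coordLine hb x i).inv (hb0 _)).neg).deriv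
  simp only [zero_smul, Torus.proj_zero, add_zero, neg_div, neg_neg] at h
  exact h

/-! ## §2 Collision sums over finitely many collision times are additive -/

section CollisionSums

variable {d : Type*} [Fintype d] {X : Type*} {M : ℕ} {G : Geometry d X} {ε : ℝ}
  {γ : ℝ → Config M d X} {S : Set ℝ}

/-- Additivity of real collision sums in the functional (finitely many collision times). [folklore] -/
theorem collisionSum_add (hfin : (collisionTimes G ε γ ∩ S).Finite)
    (F F' : HardSphereCollisionRecord d X M → ℝ) :
    collisionSum G ε γ S (fun c => F c + F' c) = collisionSum G ε γ S F + collisionSum G ε γ S F' := by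
  simp only [collisionSum_eq_finset_sum hfin, Finset.sum_add_distrib]

/-- Collision sums of a difference of functionals (finitely many collision times). [folklore] -/
theorem collisionSum_sub (hfin : (collisionTimes G ε γ ∩ S).Finite)
    (F F' : HardSphereCollisionRecord d X M → ℝ) :
    collisionSum G ε γ S (fun c => F c - F' c) = collisionSum G ε γ S F - collisionSum G ε γ S F' := by
  simp only [collisionSum_eq_finset_sum hfin, Finset.sum_sub_distrib]

/-- Collision sums commute with finite sums of functionals (finitely many collision times). [folklore] -/
theorem collisionSum_finset_sum (hfin : (collisionTimes G ε γ ∩ S).Finite) {ι : Type*} (s : Finset ι)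
    (F : ι → HardSphereCollisionRecord d X M → ℝ) :
    collisionSum G ε γ S (fun c => ∑ k ∈ s, F k c) = ∑ k ∈ s, collisionSum G ε γ S (F k) := by
  simp only [collisionSum_eq_finset_sum hfin]
  symm
  rw [Finset.sum_comm]
  exact Finset.sum_congr rfl fun t _ => Finset.sum_comm

end CollisionSums

/-! ## §3 Continuous one-body functionals are interval integrable along a good orbit -/

section Orbit

variable {ε : ℝ} {M : ℕ}

/-- A good orbit of the hard-sphere flow on `𝕋³` is measurable in time. [folklore] -/
theorem measurable_orbit (Φ : HardSphereFlow (Torus.geometry (Fin 3)) ε M) {z : Config M (Fin 3) T3}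
    (hz : z ∈ Φ.good) : Measurable fun r : ℝ => Φ.flow r z :=
  (Φ.measurable_flow_prod HemisphereAffineSlaving.BalanceIdentity.torus_continuous_translate).comp
    ((measurable_const (a := (⟨z, hz⟩ : Φ.good))).prodMk measurable_id)

/-- Along a good orbit every velocity is bounded by the conserved kinetic energy: `‖v_i(r)‖ ≤ 1 + 2E(z)`.
[folklore] -/
theorem norm_vel_flow_le (Φ : HardSphereFlow (Torus.geometry (Fin 3)) ε M) {z : Config M (Fin 3) T3}
    (hz : z ∈ Φ.good) (r : ℝ) (i : Fin M) : ‖(Φ.flow r z i).2‖ ≤ 1 + 2 * configEnergy z := by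
  -- adapted from `HydroLimitInBandContinuity.norm_vel_flow_sq_le` (9133 streaming file)
  have hE : configEnergy (Φ.flow r z) = configEnergy z := by
    have h := IsHardSphereTrajectory.configEnergy_eq_holds (Φ.isTrajectory z hz) r 0
    rwa [Φ.flow_zero z hz] at h
  have h1 : ‖(Φ.flow r z i).2‖ ^ 2 ≤ ∑ j, ‖(Φ.flow r z j).2‖ ^ 2 :=
    Finset.single_le_sum (fun j _ => sq_nonneg ‖(Φ.flow r z j).2‖) (Finset.mem_univ i)
  have h2 : ∑ j, ‖(Φ.flow r z j).2‖ ^ 2 = 2 * configEnergy z := by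
    rw [← hE, configEnergy]
    ring
  nlinarith [sq_nonneg (‖(Φ.flow r z i).2‖ - 1), norm_nonneg (Φ.flow r z i).2]

/-- **Continuous one-body functionals are interval integrable along a good orbit**: for `F` continuous on
`𝕋³ × ℝ³`, `r ↦ Σ_i F(x_i(r), v_i(r))` is interval integrable on every `[a, b]` (measurable in time; bounded, the
positions ranging in the compact torus and the velocities in the energy ball). [folklore] -/
theorem intervalIntegrable_sum_orbit (Φ : HardSphereFlow (Torus.geometry (Fin 3)) ε M)
    {z : Config M (Fin 3) T3} (hz : z ∈ Φ.good) {F : T3 × V3 → ℝ} (hF : Continuous F) (a b : ℝ) :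
    IntervalIntegrable (fun r => ∑ i, F (Φ.flow r z i)) volume a b := by
  obtain ⟨C, hC⟩ := (isCompact_univ.prod (isCompact_closedBall (0 : V3) (1 + 2 * configEnergy z)))
    |>.exists_bound_of_continuousOn hF.continuousOn
  have hmeas : Measurable fun r => ∑ i, F (Φ.flow r z i) :=
    Finset.measurable_sum _ fun i _ =>
      hF.measurable.comp ((measurable_pi_apply i).comp (measurable_orbit Φ hz))
  have hbd : ∀ r, ‖∑ i, F (Φ.flow r z i)‖ ≤ ∑ _i : Fin M, C := fun r =>
    (norm_sum_le _ _).trans (Finset.sum_le_sum fun i _ => hC _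
      (Set.mem_prod.2 ⟨mem_univ _, mem_closedBall_zero_iff.2 (norm_vel_flow_le Φ hz r i)⟩))
  exact (IntegrableOn.of_bound isCompact_uIcc.measure_lt_top hmeas.aestronglyMeasurable _
    (ae_of_all _ hbd)).intervalIntegrable

/-- Finite sums of interval integrable real functions are interval integrable (pointwise form). [folklore] -/
theorem intervalIntegrable_finset_sum {ι : Type*} (s : Finset ι) {f : ι → ℝ → ℝ} {a b : ℝ}
    (h : ∀ i ∈ s, IntervalIntegrable (f i) volume a b) :
    IntervalIntegrable (fun r => ∑ i ∈ s, f i r) volume a b := by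
  have hfun : (fun r => ∑ i ∈ s, f i r) = ∑ i ∈ s, f i := by
    funext r
    simp [Finset.sum_apply]
  rw [hfun]
  exact IntervalIntegrable.sum s h

end Orbit

/-! ## §4 The pair kernel on contact pairs -/

/-- `Σ_k |x_k| ≤ 2‖x‖` on `ℝ³` (Cauchy–Schwarz, `√3 ≤ 2`). [folklore] -/
theorem sum_abs_apply_le_two_mul_norm (x : V3) : ∑ k, |x k| ≤ 2 * ‖x‖ := by
  have h1 : (∑ k, |x k|) ^ 2 ≤ 3 * ∑ k, |x k| ^ 2 := by
    have := sq_sum_le_card_mul_sum_sq (s := Finset.univ) (f := fun k : Fin 3 => |x k|)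
    simpa using this
  have h2 : ∑ k, |x k| ^ 2 = ‖x‖ ^ 2 := by
    rw [EuclideanSpace.norm_sq_eq]
    simp [Real.norm_eq_abs]
  have h0 : 0 ≤ ∑ k, |x k| := Finset.sum_nonneg fun k _ => abs_nonneg _
  rw [← sq_le_sq₀ h0 (by positivity)]
  nlinarith [sq_nonneg ‖x‖]

/-- **The frozen pair kernel is dominated by the transfer impulse**: if the momentum-row test functions
`u₀_k/θ₀` and the energy-row test function `−θ₀⁻¹` are `L`-Lipschitz for the minimal-image distance and the two
partners of the record are at distance `≤ ε`, then
`|K c| ≤ L ε (‖Δv_fst‖ + |Δ‖v_fst‖²|/2)`. [folklore] -/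
theorem abs_pairKernel_le {M : ℕ} {θ₀ : T3 → ℝ} {u₀ : T3 → V3} {L ε : ℝ} (hL : 0 ≤ L) (hε : 0 ≤ ε)
    (hLm : ∀ (k : Fin 3) (x y : T3), |u₀ x k / θ₀ x - u₀ y k / θ₀ y| ≤ L * Torus.euclidDist x y)
    (hLe : ∀ x y : T3, |(-(θ₀ x)⁻¹) - (-(θ₀ y)⁻¹)| ≤ L * Torus.euclidDist x y)
    (c : HardSphereCollisionRecord (Fin 3) T3 M) (hc : Torus.euclidDist c.fstPos c.sndPos ≤ ε) :
    |((∑ k : Fin 3, (u₀ c.fstPos k / θ₀ c.fstPos - u₀ c.sndPos k / θ₀ c.sndPos) *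
          (c.postVel.1 k - c.preVel.1 k)) -
        ((θ₀ c.fstPos)⁻¹ - (θ₀ c.sndPos)⁻¹) * ((‖c.postVel.1‖ ^ 2 - ‖c.preVel.1‖ ^ 2) / 2)) / 2| ≤
      L * ε * (‖c.postVel.1 - c.preVel.1‖ + |‖c.postVel.1‖ ^ 2 - ‖c.preVel.1‖ ^ 2| / 2) := by
  have hLε : 0 ≤ L * ε := mul_nonneg hL hε
  have h1 : ∀ k, |(u₀ c.fstPos k / θ₀ c.fstPos - u₀ c.sndPos k / θ₀ c.sndPos) *
      (c.postVel.1 k - c.preVel.1 k)| ≤ L * ε * |(c.postVel.1 - c.preVel.1) k| := fun k => by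
    rw [abs_mul, PiLp.sub_apply]
    exact mul_le_mul_of_nonneg_right ((hLm k _ _).trans (by gcongr)) (abs_nonneg _)
  have h2 : |((θ₀ c.fstPos)⁻¹ - (θ₀ c.sndPos)⁻¹) * ((‖c.postVel.1‖ ^ 2 - ‖c.preVel.1‖ ^ 2) / 2)| ≤
      L * ε * (|‖c.postVel.1‖ ^ 2 - ‖c.preVel.1‖ ^ 2| / 2) := by
    rw [abs_mul, abs_div, abs_two]
    refine mul_le_mul_of_nonneg_right ?_ (by positivity)
    have h := hLe c.fstPos c.sndPos
    rw [neg_sub_neg, abs_sub_comm] at h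
    exact h.trans (by gcongr)
  have h3 := sum_abs_apply_le_two_mul_norm (c.postVel.1 - c.preVel.1)
  have h4 : |∑ k : Fin 3, (u₀ c.fstPos k / θ₀ c.fstPos - u₀ c.sndPos k / θ₀ c.sndPos) *
      (c.postVel.1 k - c.preVel.1 k)| ≤ L * ε * (2 * ‖c.postVel.1 - c.preVel.1‖) := by
    refine (Finset.abs_sum_le_sum_abs _ _).trans ((Finset.sum_le_sum fun k _ => h1 k).trans ?_)
    rw [← Finset.mul_sum]
    exact mul_le_mul_of_nonneg_left h3 hLε
  have h5 := abs_sub (∑ k : Fin 3, (u₀ c.fstPos k / θ₀ c.fstPos - u₀ c.sndPos k / θ₀ c.sndPos) *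
      (c.postVel.1 k - c.preVel.1 k))
    (((θ₀ c.fstPos)⁻¹ - (θ₀ c.sndPos)⁻¹) * ((‖c.postVel.1‖ ^ 2 - ‖c.preVel.1‖ ^ 2) / 2))
  have h6 : 0 ≤ L * ε * |‖c.postVel.1‖ ^ 2 - ‖c.preVel.1‖ ^ 2| := mul_nonneg hLε (abs_nonneg _)
  rw [abs_div, abs_two]
  nlinarith [h2, h4, h5, h6, norm_nonneg (c.postVel.1 - c.preVel.1)]

/-! ## §5 Continuity of the integrands -/

section Continuity

/-- Continuity of the momentum-row streaming integrand (abstract coefficients). [folklore] -/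
theorem continuous_rowIntegrand {D θ ρ Zf Z'f : T3 → ℝ} {u : T3 → V3} (hD : Continuous D) (hθ : Continuous θ)
    (hρ : Continuous ρ) (hZ : Continuous Zf) (hZ' : Continuous Z'f) (hu : Continuous u) (σ : ℝ) :
    Continuous fun y : T3 × V3 => D y.1 * (θ y.1 * (ρ y.1 * σ ^ 3) * Z'f y.1 +
      1 / 3 * (Zf y.1 - 1) * ‖y.2 - u y.1‖ ^ 2) := by
  fun_prop

/-- Continuity of the energy-row streaming integrand (abstract coefficients). [folklore] -/
theorem continuous_energyIntegrand {θ ρ Zf Z'f : T3 → ℝ} {D : Fin 3 → T3 → ℝ} {u : T3 → V3}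
    (hD : ∀ l, Continuous (D l)) (hθ : Continuous θ) (hρ : Continuous ρ) (hZ : Continuous Zf)
    (hZ' : Continuous Z'f) (hu : Continuous u) (σ : ℝ) :
    Continuous fun y : T3 × V3 => (∑ l : Fin 3, u y.1 l * D l y.1) *
        (θ y.1 * (ρ y.1 * σ ^ 3) * Z'f y.1 + 1 / 3 * (Zf y.1 - 1) * ‖y.2 - u y.1‖ ^ 2) +
      θ y.1 * (Zf y.1 - 1) * (∑ l : Fin 3, D l y.1 * (y.2 - u y.1) l) := by
  fun_prop

/-- Continuity of the momentum-row centring integrand (abstract coefficients). [folklore] -/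
theorem continuous_rowCentring {D θ ρ Z'f : T3 → ℝ} (hD : Continuous D) (hθ : Continuous θ)
    (hρ : Continuous ρ) (hZ' : Continuous Z'f) (σ : ℝ) :
    Continuous fun x : T3 => ρ x * D x * (θ x * (ρ x * σ ^ 3) * Z'f x) := by
  fun_prop

/-- Continuity of the energy-row centring integrand (abstract coefficients). [folklore] -/
theorem continuous_energyCentring {θ ρ Z'f : T3 → ℝ} {D : Fin 3 → T3 → ℝ} {u : T3 → V3}
    (hD : ∀ l, Continuous (D l)) (hθ : Continuous θ) (hρ : Continuous ρ) (hZ' : Continuous Z'f)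
    (hu : Continuous u) (σ : ℝ) :
    Continuous fun x : T3 => ρ x * (∑ l : Fin 3, u x l * D l x) * (θ x * (ρ x * σ ^ 3) * Z'f x) := by
  fun_prop

end Continuity

end Summit.AtomisticToContinuum.HydrodynamicLimit.Theorems.ClampedCurrentsDockCollisionalIdPrelim

end
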